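/-
Origin: expansion seat `planner-pub-hodgecm-pv15-g2-0`, handover #8 2026-08-18T07:11:59Z (`HOME/pub-hodgecm-pv15-g2/lean/Pv15g2/KernelModelUnfold.lean`, md5 b3c1fb0f, 94 lines);
landed by the gen-7 packager in gate run 25 as `HodgeCM/Automorphic/KernelModelUnfold.lean` (import ^import Pv15g2\.→import HodgeCM.Automorphic. ×2).
-/
/-
Origin: HOME/pub-hodgecm-pv15-g2/lean/Pv15g2/KernelModelUnfold.lean — session planner-pub-hodgecm-pv15-g2-0
(unit pub-hodgecm-pv15-g2, DAG-NODE PROVER #15 gen 2; lineage N23a → N23c input `unfold` [AX12(ii)]).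
Intended final place (packager's call): `HodgeCM/Automorphic/KernelModelUnfold.lean`.
NEW, ADDITIVE LEAF; imports my queued `Pv15g2.KernelModelAnnihilation` (↦ `HodgeCM.Automorphic.KernelModelAnnihilation`,
run-25 file 6/6; it brings pv06-g3's `HodgeCM.PerL34.AnnihilationModel` with `translC`, `QuotientTorusDatum`) and
`Pv15g2.UnfoldAnnihilation` (↦ `HodgeCM.Automorphic.UnfoldAnnihilation`, file 7/7).  KIND: KERNEL — nothing cited/posited.
-/
import Summits.HodgeConjecture.HodgeCM.Automorphic.KernelModelAnnihilation
import Summits.HodgeConjecture.HodgeCM.Automorphic.UnfoldAnnihilation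

/-!
# `QuotientTorusDatum.unfold` [AX12(ii)] for the kernel-model torus carrier, in pv06-g3's literal typing

pv06-g3's `QuotientTorusDatum ν C D` (queued `HodgeCM/PerL34/AnnihilationModel.lean`) carries the field

  `unfold : ∀ (x : C(G ⧸ Γ, ℂ)) (χ : D.X), (∀ f, ⟪D.E χ f, toLp x⟫ = 0) → ∀ h : G, PT (emb χ) (translC h x) = 0`

labelled **[AX12(ii)]** (PerL v5 Prop 3.6 Step 2, ll. 423–426).  For `D` the torus carrier of a KERNEL-MODEL datum
(`Dk : KernelTorusCarrier K T`, `D = Dk.toRegTorusCarrier.toRepTorusCarrier`, so `D.E χ f = E^χ_f ∈ L²(μQ)` is the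
pseudo-Eisenstein vector `RegularRep.EisL2 …`), this file PROVES that field from `UnfoldAnnihilation` for EVERY period
model `PT`/`emb` that reads `PT (emb χ)` as the β-weighted toric period against `conj χ`
(`hP : PT (emb χ) y = ∫_T β(t) conj χᵥ(t) y(π (jT t)⁻¹) dν(t)`):

* `KernelTorusCarrier.unfold_holds` — exactly the field's statement, under the cocompact Haar model hypothesis;
* `KernelTorusCarrier.unfold_holds_toricPeriodCLM` — the same for the canonical model `PT (emb χ) := toricPeriodCLM …`
  (no hypothesis `hP`).

So of pv06-g3's 07:04Z NET RESIDUAL for N23c per torus side ("DATA + `Ew_eq`/`emb_surj`/`comm`/`res_spec`/`res_transl`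
[DEFINITIONAL] + `unfold` [AX12(ii)] + `hsep`, `dense` [PRINT]"), `unfold` is discharged at kernel level for any datum
whose `PT ∘ emb` is (provably equal to) the β-weighted period; for their compact-model construction
`PT ξ := periodCLM μK ξ ∘ res` the equation `hP` is the β-unfolding identity of `[T]` [DEFINITIONAL, tex l. 405:
`β` a `T(L₀)`-partition of unity] — see GAPS.md pv15g2-K6.
-/

set_option autoImplicit false

noncomputable section

open MeasureTheory Set Filter Function Topology
open scoped InnerProductSpace CompactlySupported

attribute [-instance] Quotient.instMeasurableSpace

namespace HodgeCM

open HodgeCM.PerL34 HodgeCM.PerL34.N23a HodgeCM.PerL34.Annihilation HodgeCM.RegularRep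

namespace KernelTorusCarrier

variable {G : Type} [Group G] [TopologicalSpace G] [IsTopologicalGroup G] [T2Space G] [LocallyCompactSpace G]
  [MeasurableSpace G] [BorelSpace G]
variable {Γ : Subgroup G} [DiscreteTopology Γ] [IsClosed (Γ : Set G)] [MeasurableSpace (G ⧸ Γ)] [BorelSpace (G ⧸ Γ)]
  [CompactSpace (G ⧸ Γ)]
variable {μQ : Measure (G ⧸ Γ)} [SMulInvariantMeasure G (G ⧸ Γ) μQ] [IsFiniteMeasure μQ]
variable {XU : Type} [TopologicalSpace XU] [CompactSpace XU]
variable {HG : Type} [NormedAddCommGroup HG] [InnerProductSpace ℂ HG] [CompleteSpace HG]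
variable {SK SigIdxG : Type} [TopologicalSpace SK]
variable {K : KernelCoreCarrier G Γ μQ XU HG SK SigIdxG}
variable {T : Type} [Group T] [TopologicalSpace T] [T2Space T] [MeasurableSpace T] [OpensMeasurableSpace T]
variable (Dk : KernelTorusCarrier K T) [IsFiniteMeasureOnCompacts Dk.ν]

/-- **`QuotientTorusDatum.unfold` [AX12(ii)] PROVED for the kernel-model torus carrier**, for any period model
`(Xall, PT, emb)` in which `PT (emb χ)` is the β-weighted toric period against `conj χᵥ`:
`x ⟂ 𝓔_χ` in `L²(μQ)` forces `PT (emb χ) (translC h x) = 0` for every `h ∈ G` (PerL v5 ll. 423–426). -/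
theorem unfold_holds {μ : Measure G} (hM : IsCocompactHaarModel Γ μQ μ)
    {Xall : Type} (PT : Xall → (C(G ⧸ Γ, ℂ) →L[ℂ] ℂ)) (emb : Dk.X → Xall)
    (hP : ∀ (χ : Dk.X) (y : C(G ⧸ Γ, ℂ)),
      PT (emb χ) y = ∫ t, wt Dk.β (star (Dk.χv χ)) t * y (QuotientGroup.mk (Dk.jT t)⁻¹) ∂Dk.ν) :
    ∀ (x : C(G ⧸ Γ, ℂ)) (χ : Dk.X),
      (∀ f, ⟪Dk.toRegTorusCarrier.toRepTorusCarrier.E χ f, ContinuousMap.toLp (E := ℂ) 2 μQ ℂ x⟫_ℂ = 0) →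
      ∀ h : G, PT (emb χ) (translC h x) = 0 := by
  intro x χ hx h
  exact unfold_of_periodModel Dk.ν Dk.jT Dk.β (Dk.χv χ) hM (discreteMeets_of_discrete Γ) (PT (emb χ)) (hP χ)
    (fun g y => translC g y) (fun g y q => translC_apply_apply g y q) x
    (fun f => by simpa only [RegTorusCarrier.toRepTorusCarrier_E, toRegTorusCarrier_E] using hx f) h

/-- The canonical period model `PT (emb χ) := toricPeriodCLM ν (β conj χᵥ) (π ∘ inv ∘ jT)`: `unfold` holds outright. -/
theorem unfold_holds_toricPeriodCLM {μ : Measure G} (hM : IsCocompactHaarModel Γ μQ μ)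
    {Xall : Type} (PT : Xall → (C(G ⧸ Γ, ℂ) →L[ℂ] ℂ)) (emb : Dk.X → Xall)
    (hP : ∀ χ : Dk.X, PT (emb χ) =
      toricPeriodCLM Dk.ν (continuous_wt_star Dk.β (Dk.χv χ)) (hasCompactSupport_wt_star Dk.β (Dk.χv χ))
        (QuotientGroup.continuous_mk.comp (continuous_inv.comp Dk.jT.continuous) :
          Continuous fun t : T => (QuotientGroup.mk (Dk.jT t)⁻¹ : G ⧸ Γ))) :
    ∀ (x : C(G ⧸ Γ, ℂ)) (χ : Dk.X),
      (∀ f, ⟪Dk.toRegTorusCarrier.toRepTorusCarrier.E χ f, ContinuousMap.toLp (E := ℂ) 2 μQ ℂ x⟫_ℂ = 0) →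
      ∀ h : G, PT (emb χ) (translC h x) = 0 :=
  Dk.unfold_holds hM PT emb (fun χ y => by rw [hP χ, toricPeriodCLM_apply]; rfl)

end KernelTorusCarrier

end HodgeCM

end
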